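import Mathlib
import HarnessLib
import Summits.KontsevichZagierPeriods.Zeta5Search.Denom.LineProfile

/-!
# Shape of the P15 line profile at `ξ = 26/5` (P15 kernel, brick E5-4a)

HONEST FRAMING: systematic search; no irrationality claim unless certified.  This file proves
elementary real-analysis facts about an explicit function of one variable; no statement about
`ζ(2)`, `ζ(5)` or any linear form is made here.

Let `P15 η = profile (26/5) η` be the line profile of `Denom/LineProfile.lean` at the abscissa
`ξ = 26/5` (cell record `families/denom/P15KERNEL.md` §6, §8) and
`D15 η = angle (26/5) η − 2π` its derivative on `(0, ∞)` (`hasDerivAt_P15`).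

* `D15_eq`: `D15 = numLegs − denAngle − 2π`, where `numLegs` is the sum of the six angles
  `arctan (w/η)`, `w ∈ {36, 29, 26, 19, 16, 9}/5` (each antitone in `η > 0`), and
  `denAngle η = arctan (101/(5η)) − arctan (46/(5η)) = arctan (11η/(η² + 4646/25))`
  (`denAngle_eq`, from `Real.arctan_add`) is monotone on `(0, 13]` since `13² < 4646/25`.
* `D15_antitoneOn`: `D15` is antitone on `(0, 13]`;  `D15_neg_of_ge`: `D15 < 0` on `[13, ∞)`
  (`arctan x ≤ x`, `27/13 < 6 < 2π`).
* `twoPoint` (two-point tangent lemma): if `0 < η₁ ≤ η₂ ≤ 13`, `0 ≤ D15 η₁` and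
  `D15 η₂ ≤ 0`, then `P15 η ≤ P15 η₁ + D15 η₁ · (η₂ − η₁)` for every `η > 0`
  (mean-value bounds `monotoneOn_of_deriv_nonneg`, `Convex.image_sub_le_mul_sub_of_deriv_le`,
  `antitoneOn_of_deriv_nonpos`).
* `P15_eq`: `P15` as the signed sum of eight values `gPrim η (p/5)` plus `profileConst − 2π|η|`.

The numerical instance (`η₁ = 2.1504`, `η₂ = 2.1506`) is certified in
`Denom/TwoTaleP15LineCertificate.lean`.
-/

noncomputable section

open Real Set

namespace Summit.KontsevichZagierPeriods.Zeta5Search.Denom.LineProfileShape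

open Summit.KontsevichZagierPeriods.Zeta5Search.Denom.LineProfile

/-- `P15 η = profile (26/5) η`. -/
def P15 (η : ℝ) : ℝ := profile (26 / 5) η

/-- `D15 η = angle (26/5) η − 2π` (the derivative of `P15` on `(0, ∞)`). -/
def D15 (η : ℝ) : ℝ := angle (26 / 5) η - 2 * Real.pi

/-- The six numerator legs `arctan (w/η)`, `w ∈ {36, 29, 26, 19, 16, 9}/5`. -/
def numLegs (η : ℝ) : ℝ :=
  Real.arctan (36 / 5 / η) + Real.arctan (29 / 5 / η) + Real.arctan (26 / 5 / η)
    + Real.arctan (19 / 5 / η) + Real.arctan (16 / 5 / η) + Real.arctan (9 / 5 / η)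

/-- The denominator angle `arctan (101/(5η)) − arctan (46/(5η))`. -/
def denAngle (η : ℝ) : ℝ := Real.arctan (101 / 5 / η) - Real.arctan (46 / 5 / η)

/-- `d/dη P15 = D15` on `(0, ∞)`. -/
theorem hasDerivAt_P15 {η : ℝ} (hη : 0 < η) : HasDerivAt P15 (D15 η) η :=
  hasDerivAt_profile_eta (26 / 5) hη

/-- `D15 = numLegs − denAngle − 2π`. -/
theorem D15_eq (η : ℝ) : D15 η = numLegs η - denAngle η - 2 * Real.pi := by
  simp only [D15, angle, numLegs, denAngle]
  have e1 : ((26 : ℝ) / 5 + 2) / η = 36 / 5 / η := by ring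
  have e2 : ((26 : ℝ) / 5 - 11) / η = -(29 / 5 / η) := by ring
  have e3 : ((26 : ℝ) / 5 - 9) / η = -(19 / 5 / η) := by ring
  have e4 : ((26 : ℝ) / 5 - 2) / η = 16 / 5 / η := by ring
  have e5 : ((26 : ℝ) / 5 - 7) / η = -(9 / 5 / η) := by ring
  have e6 : ((26 : ℝ) / 5 + 15) / η = 101 / 5 / η := by ring
  have e7 : ((26 : ℝ) / 5 + 4) / η = 46 / 5 / η := by ring
  rw [e1, e2, e3, e4, e5, e6, e7, Real.arctan_neg, Real.arctan_neg, Real.arctan_neg]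
  ring

/-- `P15 = (eight signed values of gPrim) + profileConst − 2π|η|`. -/
theorem P15_eq (η : ℝ) : P15 η =
    gPrim η (36 / 5) + gPrim η (29 / 5) + gPrim η (26 / 5) + gPrim η (19 / 5) + gPrim η (16 / 5)
      + gPrim η (9 / 5) - gPrim η (101 / 5) + gPrim η (46 / 5) + profileConst
      - 2 * Real.pi * |η| := by
  simp only [P15, profile, profile0]
  have e1 : gPrim η ((26 : ℝ) / 5 + 2) = gPrim η (36 / 5) := by norm_num
  have e2 : gPrim η ((26 : ℝ) / 5 - 11) = -gPrim η (29 / 5) := by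
    rw [show ((26 : ℝ) / 5 - 11) = -(29 / 5) by norm_num, gPrim_neg]
  have e3 : gPrim η ((26 : ℝ) / 5 - 9) = -gPrim η (19 / 5) := by
    rw [show ((26 : ℝ) / 5 - 9) = -(19 / 5) by norm_num, gPrim_neg]
  have e4 : gPrim η ((26 : ℝ) / 5 - 2) = gPrim η (16 / 5) := by norm_num
  have e5 : gPrim η ((26 : ℝ) / 5 - 7) = -gPrim η (9 / 5) := by
    rw [show ((26 : ℝ) / 5 - 7) = -(9 / 5) by norm_num, gPrim_neg]
  have e6 : gPrim η ((26 : ℝ) / 5 + 15) = gPrim η (101 / 5) := by norm_num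
  have e7 : gPrim η ((26 : ℝ) / 5 + 4) = gPrim η (46 / 5) := by norm_num
  rw [e1, e2, e3, e4, e5, e6, e7]
  ring

-- lane edit (lead/lit g13, dedup.landed): the folklore lemma `arctan t ≤ t` (t ≥ 0) restated a landed Literature lemma
-- (`Literature.NumberTheory.LFunctions.arctan_le_self`); it is inlined at its single use site below.

/-- Each leg `arctan (c/η)`, `c ≥ 0`, is antitone in `η > 0`. -/
theorem arctan_div_anti (c : ℝ) (hc : 0 ≤ c) {s t : ℝ} (hs : 0 < s) (hst : s ≤ t) :
    Real.arctan (c / t) ≤ Real.arctan (c / s) :=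
  Real.arctan_mono (div_le_div_of_nonneg_left hc hs hst)

/-- Closed form `denAngle η = arctan (11η / (η² + 4646/25))` for `η > 0` (`Real.arctan_add`). -/
theorem denAngle_eq {η : ℝ} (hη : 0 < η) :
    denAngle η = Real.arctan (11 * η / (η ^ 2 + 4646 / 25)) := by
  have hη' : η ≠ 0 := hη.ne'
  unfold denAngle
  have hx : 0 < 101 / 5 / η := by positivity
  have hy : 0 < 46 / 5 / η := by positivity
  have h1 : (101 / 5 / η) * (-(46 / 5 / η)) < 1 := by nlinarith
  rw [sub_eq_add_neg, ← Real.arctan_neg, Real.arctan_add h1]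
  congr 1
  have hD1 : (1 - 101 / 5 / η * -(46 / 5 / η)) ≠ 0 := by
    have : 0 < 1 - 101 / 5 / η * -(46 / 5 / η) := by nlinarith [mul_pos hx hy]
    exact this.ne'
  have hD2 : η ^ 2 + 4646 / 25 ≠ 0 := by positivity
  rw [div_eq_div_iff hD1 hD2]
  field_simp
  ring

/-- `denAngle` is monotone on `(0, 13]`. -/
theorem denAngle_mono {s t : ℝ} (hs : 0 < s) (hst : s ≤ t) (ht : t ≤ 13) :
    denAngle s ≤ denAngle t := by
  rw [denAngle_eq hs, denAngle_eq (hs.trans_le hst)]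
  apply Real.arctan_mono
  rw [div_le_div_iff₀ (by positivity) (by positivity)]
  have hst' : s * t ≤ 13 * 13 := mul_le_mul (hst.trans ht) ht (hs.le.trans hst) (by norm_num)
  nlinarith [mul_nonneg (sub_nonneg.2 hst) (by linarith : (0 : ℝ) ≤ 4646 / 25 - s * t)]

/-- `D15` is antitone on `(0, 13]`. -/
theorem D15_antitoneOn {s t : ℝ} (hs : 0 < s) (hst : s ≤ t) (ht : t ≤ 13) : D15 t ≤ D15 s := by
  rw [D15_eq, D15_eq]
  have hd := denAngle_mono hs hst ht
  have l1 := arctan_div_anti (36 / 5) (by norm_num) hs hst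
  have l2 := arctan_div_anti (29 / 5) (by norm_num) hs hst
  have l3 := arctan_div_anti (26 / 5) (by norm_num) hs hst
  have l4 := arctan_div_anti (19 / 5) (by norm_num) hs hst
  have l5 := arctan_div_anti (16 / 5) (by norm_num) hs hst
  have l6 := arctan_div_anti (9 / 5) (by norm_num) hs hst
  unfold numLegs
  linarith

/-- `D15 η < 0` for `η ≥ 13` (`arctan x ≤ x`, `27/13 < 2π`). -/
theorem D15_neg_of_ge {η : ℝ} (hη : 13 ≤ η) : D15 η < 0 := by
  rw [D15_eq]
  have hη0 : 0 < η := by linarith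
  have hden : 0 ≤ denAngle η := by
    unfold denAngle
    have : Real.arctan (46 / 5 / η) ≤ Real.arctan (101 / 5 / η) :=
      Real.arctan_mono (div_le_div_of_nonneg_right (by norm_num) hη0.le)
    linarith
  have leg : ∀ c : ℝ, 0 ≤ c → Real.arctan (c / η) ≤ c / 13 := fun c hc =>
    (show Real.arctan (c / η) ≤ c / η from by
      have ht : (0:ℝ) ≤ c / η := div_nonneg hc hη0.le
      have h0 : 0 ≤ Real.arctan (c / η) := by simpa using Real.arctan_mono ht
      have h := Real.le_tan h0 (Real.arctan_lt_pi_div_two _)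
      rwa [Real.tan_arctan] at h).trans
      (div_le_div_of_nonneg_left hc (by norm_num) hη)
  have l1 := leg (36 / 5) (by norm_num)
  have l2 := leg (29 / 5) (by norm_num)
  have l3 := leg (26 / 5) (by norm_num)
  have l4 := leg (19 / 5) (by norm_num)
  have l5 := leg (16 / 5) (by norm_num)
  have l6 := leg (9 / 5) (by norm_num)
  unfold numLegs
  nlinarith [Real.pi_gt_three]

/-- **Two-point tangent lemma.**  If `0 < η₁ ≤ η₂ ≤ 13`, `0 ≤ D15 η₁` and `D15 η₂ ≤ 0`, then
`P15 η ≤ P15 η₁ + D15 η₁ · (η₂ − η₁)` for every `η > 0`. -/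
theorem twoPoint {η₁ η₂ : ℝ} (h1 : 0 < η₁) (h12 : η₁ ≤ η₂) (h2 : η₂ ≤ 13) (hD1 : 0 ≤ D15 η₁)
    (hD2 : D15 η₂ ≤ 0) {η : ℝ} (hη : 0 < η) : P15 η ≤ P15 η₁ + D15 η₁ * (η₂ - η₁) := by
  have cont : ∀ a b : ℝ, 0 < a → ContinuousOn P15 (Icc a b) := fun a b ha =>
    (continuousOn_profile (26 / 5)).mono fun x hx => lt_of_lt_of_le ha hx.1
  have diff : ∀ a b : ℝ, 0 < a → DifferentiableOn ℝ P15 (interior (Icc a b)) :=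
    fun a b ha x hx => by
      rw [interior_Icc] at hx
      exact (hasDerivAt_P15 (ha.trans hx.1)).differentiableAt.differentiableWithinAt
  have der : ∀ x : ℝ, 0 < x → deriv P15 x = D15 x := fun x hx => (hasDerivAt_P15 hx).deriv
  have h2pos : 0 < η₂ := h1.trans_le h12
  -- the tangent bound on `[η₁, y]` for `y ≤ η₂`
  have mid : ∀ y : ℝ, η₁ ≤ y → y ≤ η₂ → P15 y - P15 η₁ ≤ D15 η₁ * (y - η₁) :=
    fun y hy1 hy2 =>
    (convex_Icc η₁ y).image_sub_le_mul_sub_of_deriv_le (cont η₁ y h1) (diff η₁ y h1)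
      (C := D15 η₁)
      (fun x hx => by
        rw [interior_Icc] at hx
        rw [der x (h1.trans hx.1)]
        exact D15_antitoneOn h1 hx.1.le (by linarith [hx.2]))
      η₁ ⟨le_rfl, hy1⟩ y ⟨hy1, le_rfl⟩ hy1
  rcases le_total η η₁ with hle | hge
  · have mono : MonotoneOn P15 (Icc η η₁) :=
      monotoneOn_of_deriv_nonneg (convex_Icc η η₁) (cont η η₁ hη) (diff η η₁ hη) fun x hx => by
        rw [interior_Icc] at hx
        rw [der x (hη.trans hx.1)]
        exact hD1.trans (D15_antitoneOn (hη.trans hx.1) hx.2.le (h12.trans h2))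
    have := mono ⟨le_rfl, hle⟩ ⟨hle, le_rfl⟩ hle
    nlinarith [mul_nonneg hD1 (sub_nonneg.2 h12)]
  · rcases le_total η η₂ with hle2 | hge2
    · have := mid η hge hle2
      nlinarith [mul_le_mul_of_nonneg_left (by linarith : η - η₁ ≤ η₂ - η₁) hD1]
    · have anti : AntitoneOn P15 (Icc η₂ η) :=
        antitoneOn_of_deriv_nonpos (convex_Icc η₂ η) (cont η₂ η h2pos) (diff η₂ η h2pos)
          fun x hx => by
            rw [interior_Icc] at hx
            rw [der x (h2pos.trans hx.1)]
            rcases le_or_gt x 13 with hx13 | hx13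
            · exact (D15_antitoneOn h2pos hx.1.le hx13).trans hD2
            · exact (D15_neg_of_ge hx13.le).le
      have hA := anti ⟨le_rfl, hge2⟩ ⟨hge2, le_rfl⟩ hge2
      have := mid η₂ h12 le_rfl
      linarith

end Summit.KontsevichZagierPeriods.Zeta5Search.Denom.LineProfileShape

end
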